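import Literature.AlgebraicGeometry.Motives.HodgeThetaSubalgebraUnitaryQuartic
import Literature.AlgebraicGeometry.Motives.MumfordTateInvariantsDualForm
import HarnessLib

/-!
# The `Θ`-subalgebra theorem for a generic weight-one Hodge structure of rank four: every admissible rational
# Lie algebra is `𝔰𝔭(V, ψ)` (Moonen–Zarhin 1999 (2.2), Type I(1), `g = 2`: `Hg(X) = Sp(V, φ) ≅ Sp_{4,ℚ}`), and
# Theorem L: rational tensors killed by `Θ` are killed by `𝔰𝔭(V_ℂ, ψ_ℂ)`

Family `hodge`, layer `Literature/AlgebraicGeometry/Motives`. Research context: cell `pub-hodge-ring2` (HONEST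
FRAMING: research route conditional on HC_CM; not a corollary; Q11.4-sentence-2 already refuted in dim ≥ 3),
Literature lane, programme R11 «generic abelian surfaces», the abstract Lie step. UNCONDITIONAL linear algebra
of polarized Hodge structures; theorems only, no definition, no named fact (D-0026), no `sorry`. Sequel of
`HodgeThetaSubalgebraUnitary` (R9-1: `𝔲_K(V,ψ)`, Ribet type `(n−1,1)`) and `HodgeThetaSubalgebraUnitaryQuartic`
(R10-1: `𝔲_E(V,ψ)`, quartic CM `(2,1)`), whose grading operators, line-orbit device, irreducibility device and
plane lemma (`QuarticTheta.eq_top_of_forall_stable`: a bracket-closed Lie algebra of operators on a plane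
containing `1` without stable line is everything) are reused.

THE PRINTED THEOREM. B. Moonen, Yu. Zarhin, *Hodge classes on abelian varieties of low dimension*, Math. Ann.
315 (1999) 711–733 [`paper:arxiv-math_9901113`, held], §2 p. 715 (p0005 L19–L22): "For `g := dim(X) ≤ 3` and
`g = 5` we always find that `Hg(X) = Sp_D(V,φ)`. Since type 3 does not occur for `g ≤ 3` and `g = 5`
(`X` simple!), it follows that `B(Xⁿ) = D(Xⁿ)` for all `n`. […] In particular the Hodge conjecture is true
for all such `Xⁿ`."; (2.2) (p0005 L55–L58): "`g = 2`. […] Type 1(1): `X` is an abelian surface with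
`End⁰(X) = ℚ`. Then `Hg(X) = Sp(V,φ) ≅ Sp_{4,ℚ}`."; (1.8) (p0004 L74–L78, Hazama / Murty):
"`Hg(X) = Sp_D(V,φ) ⟺ (X has no factors of type III and D(Xⁿ) = B(Xⁿ) for all n)`".

WHAT IS PROVED (the Lie form of "`Hg(X) = Sp(V, φ)`", for an ARBITRARY admissible rational Lie algebra).
Data: an effective polarized `ℚ`-Hodge structure `H` of weight `1` on `V`, `dim_ℚ V = 4`, with
`End_Hdg(V) = ℚ` (`∀ a ∈ End_Hdg, a ∈ ℚ · 1`); a `ℚ`-subspace `𝔤 ⊆ End_ℚ(V)` closed under the commutator, whose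
elements are `ψ`-skew, and whose complex span `𝔤_ℂ` contains a Hodge operator `Θ` (`= p − q` on `V^{p,q}`) —
e.g. `𝔤 = Lie Hg(H)` (`ZarhinHodgeGroupLieAlgebra`) or the annihilator Lie algebra of a rational tensor
(`HodgeThetaAnnihilatorLieAlgebra.annLie`).

* §1 **`SymplecticTheta.core_of_irreducible`** — THE CORE, pure complex linear algebra: `M` a complex space
  with a nondegenerate alternating form `ω`, `𝔊 ⊆ End(M)` a bracket-closed space of `ω`-skew operators
  containing an involution `T` whose `±1`-eigenspaces `P`, `Q` are planes, such that `M` has no `𝔊`-stable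
  subspace other than `0`, `M`. Then `𝔊` contains every `ω`-skew operator killing `P` with values in `P`
  (the unipotent radical `𝔲⁺ ≅ Sym²`) and every `ω`-skew operator preserving `P` and `Q` (the Levi
  `𝔤𝔩(P)`). Proof: `𝔊 = 𝔊₋ ⊕ 𝔊₀ ⊕ 𝔊₊` under `ad T` (`UnitaryTheta.raise_mem`); the Lie algebra `𝔩` of
  restrictions of `𝔊₀` to the plane `P` contains `1 = T|_P`; a `𝔩`-stable LINE `ℂe ⊂ P` is impossible,
  because `ℂe ⊕ 𝔊₋e` would be a proper `𝔊`-stable subspace (`𝔊₊e = 0`, `𝔊₋ 𝔊₋ e = 0`,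
  `[𝔊₀, 𝔊₋] ⊆ 𝔊₋`, `[𝔊₊, 𝔊₋] ⊆ 𝔊₀`); so `𝔩 = 𝔤𝔩(P)` by the plane lemma, which is the Levi statement by
  `ω`-duality of `P` and `Q`; `𝔊₊ ≠ 0` (else `Q` is stable); from `0 ≠ B ∈ 𝔊₊` and `Z ∈ 𝔊₀` the bracket
  `[Z, B] ∈ 𝔊₊` has the symmetrized pairing `ω([Z,B]q, q') = ω(ZBq, q') + ω(ZBq', q)`, which makes `B`
  injective on `Q` after one bracket (rank one ⇒ rank two) and then reaches every symmetric target
  (`Z|_P = ½ Y B⁻¹`).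
* §2 **`SymplecticTheta.eq_bot_or_top_of_stable`** — IRREDUCIBILITY of `V_ℂ` under `𝔤` when `End_Hdg(V) = ℚ`:
  a `𝔤`-stable `U` is `Θ`-graded, `U† = {y : ψ_ℂ(y, conj U) = 0}` is stable with `U ∩ U† = 0` (second
  Hodge–Riemann relation on the graded pieces), so the projector onto `U` along `U†` commutes with `𝔤`, lies
  in `End_Hdg ⊗ ℂ = ℂ` and is `0` or `1` (the device of `UnitaryTheta.eq_bot_or_eq_of_stable`).
* §3 **`SymplecticTheta.mem_spanC_of_skew`** — THE THEOREM: every `ψ_ℂ`-skew operator of `V_ℂ` lies in `𝔤_ℂ`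
  (§1 applied to `T = Θ` and `T = −Θ` on `V_ℂ = V^{1,0} ⊕ V^{0,1}`, planes because `dim V = 4` and
  `h^{1,0} = h^{0,1}`); `mem_spanC_iff_skew`, `mem_iff_skew` (`𝔤 = 𝔰𝔭(V, ψ)`, descent),
  **`mem_hodgeLie_iff_skew`** (`Lie Hg(H) = 𝔰𝔭(V, ψ)`: MZ99 (2.2) "`Hg(X) = Sp(V, φ)`" in Lie form), `eq_hodgeLie`
  (uniqueness: every admissible `𝔤` IS `Lie Hg`).
* §4 **`SymplecticTheta.wordDerAt_eq_zero_of_skew`** — THEOREM L-Sp: a rational coefficient tensor killed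
  (slice by slice, diagonally) by the matrix of `Θ` is killed by the matrix of EVERY `ψ_ℂ`-skew operator
  (the annihilator Lie algebra `annLie` is admissible and `Θ ∈ 𝔞_ℂ` by descent, Deligne LNM 900 I §3).
  This is the Lie-algebra input of "`B(Xⁿ) = D(Xⁿ)` for all `n`" (MZ99 (1.8), Milne 1999 Prop. 3.6 (a)); the
  passage to `Sp`-invariants and divisor classes is `ClassicalInvariants/TensorLieInvariantsSp` +
  `SymplecticTensorFFT` + `Milne1999/SpecialLefschetzGroupInvariantsSpMultiplicity` (sequel).

NOT here: `dim V = 2g ≥ 6` (for `g = 3` the analogous Lie statement needs the exclusion of `𝔰𝔩₂ ⊗ 𝔰𝔬₃`-type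
subalgebras; for `g = 4` it is false — Mumford's examples, MZ99 (2.5)); `Hg = Sp` as algebraic groups (Lie form
only); abelian varieties (sequel `HodgeTheory/GenericAbelianSurfacePowersHodgeClasses`).

## References

* [MoonenZarhin1999LowDim] B. Moonen, Yu. Zarhin, Hodge classes on abelian varieties of low dimension, Math.
  Ann. 315 (1999) 711–733 = arXiv:math/9901113, §1 (1.8), §2 p. 715 and (2.2).
* [Gordon1997] B. B. Gordon, A survey of the Hodge conjecture for abelian varieties, arXiv:alg-geom/9709030,
  §1.6.2 (Lie algebras of Hodge groups), Thm. 7.5 (Murty / Hazama), §6 (proof of Thm. 6.3.3, p. 19).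
* [vanGeemen1994HodgeAV] B. van Geemen, An introduction to the Hodge conjecture for abelian varieties, LNM
  1594 (1994), Thm. 4.2 (Mattuck: general abelian varieties), §2.4–2.5.
* [Deligne1982HodgeCycles] P. Deligne, Hodge cycles on abelian varieties, LNM 900 (1982), I §3 Prop. 3.4.
* [Zarhin1983HodgeGroupsK3] Yu. G. Zarhin, Hodge groups of K3 surfaces, J. reine angew. Math. 341 (1983), §2.
* [Humphreys1972] J. E. Humphreys, Introduction to Lie Algebras and Representation Theory (1972), §4.1.
* [GoodmanWallachGTM255] R. Goodman, N. R. Wallach, GTM 255 (2009), §2.1.2 (`𝔰𝔭` in block form), §4.1.1.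
* [VoisinHodgeI2002] C. Voisin, Hodge Theory and Complex Algebraic Geometry I, §7.1.2 Def. 7.7.
-/

noncomputable section

open scoped TensorProduct

namespace Literature.AlgebraicGeometry.Motives

namespace HodgeStructure

/-! ### §1 The core: a bracket-closed space of skew operators containing a Lagrangian involution with plane
eigenspaces and acting irreducibly contains `𝔲⁺` and the Levi -/

section Core

variable {M : Type*} [AddCommGroup M] [Module ℂ M]

/-- **Two vectors span a plane.** In a subspace `P` of dimension `2`, a non-zero `u ∈ P` and a `w ∈ P` off the
line `ℂu` span `P`. [folklore] -/
private theorem SymplecticTheta.exists_pair_of_finrank_two [FiniteDimensional ℂ M] {P : Submodule ℂ M}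
    (hP2 : Module.finrank ℂ P = 2) {u w : M} (hu : u ∈ P) (hw : w ∈ P) (hu0 : u ≠ 0) (hwu : w ∉ (ℂ ∙ u)) :
    ∀ p ∈ P, ∃ a b : ℂ, p = a • u + b • w := by
  have hle : Submodule.span ℂ {u, w} ≤ P := by
    rw [Submodule.span_le]
    intro x hx
    rcases hx with rfl | rfl
    · exact hu
    · exact hw
  have h2 : 2 ≤ Module.finrank ℂ (Submodule.span ℂ ({u, w} : Set M)) := by
    have hlt : (ℂ ∙ u) < Submodule.span ℂ {u, w} := by
      refine lt_of_le_of_ne (Submodule.span_mono (Set.singleton_subset_iff.2 (Set.mem_insert u {w}))) ?_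
      intro h
      exact hwu (h ▸ Submodule.subset_span (Set.mem_insert_of_mem u rfl))
    have h1 := finrank_span_singleton (K := ℂ) hu0
    have h2 := Submodule.finrank_lt_finrank_of_lt hlt
    omega
  have heq : Submodule.span ℂ {u, w} = P := Submodule.eq_of_le_of_finrank_le hle (by rw [hP2]; exact h2)
  intro p hp
  rw [← heq, Submodule.mem_span_pair] at hp
  obtain ⟨a, b, rfl⟩ := hp
  exact ⟨a, b, rfl⟩

/-- **The `ad T`-grading of `𝔊`** for an involution `T ∈ 𝔊` with eigenspaces `P` (`+1`) and `Q` (`−1`): every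
`Z ∈ 𝔊` is `Z₋ + Z₀ + Z₊` with `Z₊ = PZQ ∈ 𝔊` (kills `P`, values in `P`), `Z₋ = QZP ∈ 𝔊` (kills `Q`, values
in `Q`) and `Z₀ = PZP + QZQ ∈ 𝔊` (preserves `P` and `Q`; `Z₀ p = P(Zp)`, `Z₀ q = Q(Zq)`) — the components
`([T,[T,Z]] ± 2[T,Z])/8` of `UnitaryTheta.raise_mem`. [cite: GoodmanWallachGTM255, §4.1.1 and §2.1.2]
[cite: Gordon1997, §6 (proof of Thm. 6.3.3, p. 19)] -/
theorem SymplecticTheta.exists_decomp (𝔊 : Submodule ℂ (Module.End ℂ M))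
    (hbr : ∀ Y ∈ 𝔊, ∀ Z ∈ 𝔊, Y * Z - Z * Y ∈ 𝔊) {T : Module.End ℂ M} (hT𝔊 : T ∈ 𝔊) (hTT : ∀ v, T (T v) = v)
    {P Q : Submodule ℂ M} (hP : ∀ x ∈ P, T x = x) (hQ : ∀ x ∈ Q, T x = -x)
    (hPmem : ∀ v, (2 : ℂ)⁻¹ • (v + T v) ∈ P) (hQmem : ∀ v, (2 : ℂ)⁻¹ • (v - T v) ∈ Q) {Z : Module.End ℂ M}
    (hZ : Z ∈ 𝔊) :
    ∃ Zm ∈ 𝔊, ∃ Z0 ∈ 𝔊, ∃ Zp ∈ 𝔊, Z = Zm + Z0 + Zp ∧ (∀ p ∈ P, Zp p = 0) ∧ (∀ v, Zp v ∈ P) ∧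
      (∀ q ∈ Q, Zm q = 0) ∧ (∀ v, Zm v ∈ Q) ∧ (∀ p ∈ P, Z0 p = (2 : ℂ)⁻¹ • (Z p + T (Z p))) ∧
      (∀ q ∈ Q, Z0 q = (2 : ℂ)⁻¹ • (Z q - T (Z q))) ∧ (∀ p ∈ P, Z0 p ∈ P) ∧ (∀ q ∈ Q, Z0 q ∈ Q) := by
  have hTfix : ∀ x, T x = x → x ∈ P := fun x hx => by
    have h := hPmem x
    rwa [hx, ← two_smul ℂ x, smul_smul, inv_mul_cancel₀ (two_ne_zero' ℂ), one_smul] at h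
  have hTneg : ∀ x, T x = -x → x ∈ Q := fun x hx => by
    have h := hQmem x
    rwa [hx, sub_neg_eq_add, ← two_smul ℂ x, smul_smul, inv_mul_cancel₀ (two_ne_zero' ℂ), one_smul] at h
  have hnT𝔊 : -T ∈ 𝔊 := Submodule.neg_mem _ hT𝔊
  have hnTT : ∀ v, (-T) ((-T) v) = v := fun v => by
    rw [LinearMap.neg_apply, LinearMap.neg_apply, map_neg, neg_neg, hTT]
  set Zp := (4 : ℂ)⁻¹ • (Z + T * Z - Z * T - T * Z * T) with hZp
  set Zm := (4 : ℂ)⁻¹ • (Z + (-T) * Z - Z * (-T) - (-T) * Z * (-T)) with hZm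
  have hZp𝔊 : Zp ∈ 𝔊 := UnitaryTheta.raise_mem hbr hT𝔊 hTT hZ
  have hZm𝔊 : Zm ∈ 𝔊 := UnitaryTheta.raise_mem hbr hnT𝔊 hnTT hZ
  have hZpP : ∀ p ∈ P, Zp p = 0 := fun p hp => UnitaryTheta.raise_apply_of_eq T Z (hP p hp)
  have hZpim : ∀ v, Zp v ∈ P := fun v => hTfix _ (UnitaryTheta.apply_raise_apply hTT Z v)
  have hZmQ : ∀ q ∈ Q, Zm q = 0 := fun q hq =>
    UnitaryTheta.raise_apply_of_eq (-T) Z (by rw [LinearMap.neg_apply, hQ q hq, neg_neg])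
  have hZmim : ∀ v, Zm v ∈ Q := fun v => by
    refine hTneg _ ?_
    have h := UnitaryTheta.apply_raise_apply hnTT Z v
    rw [LinearMap.neg_apply, neg_eq_iff_eq_neg] at h
    exact h
  have hZmP : ∀ p ∈ P, Zm p = (2 : ℂ)⁻¹ • (Z p - T (Z p)) := fun p hp => by
    have h := UnitaryTheta.raise_apply_of_eq_neg (-T) Z (ℓ := p) (by rw [LinearMap.neg_apply, hP p hp])
    rw [h, LinearMap.neg_apply, ← sub_eq_add_neg]
  have hZpQ : ∀ q ∈ Q, Zp q = (2 : ℂ)⁻¹ • (Z q + T (Z q)) := fun q hq =>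
    UnitaryTheta.raise_apply_of_eq_neg T Z (hQ q hq)
  refine ⟨Zm, hZm𝔊, Z - Zm - Zp, Submodule.sub_mem _ (Submodule.sub_mem _ hZ hZm𝔊) hZp𝔊, Zp, hZp𝔊, by abel,
    hZpP, hZpim, hZmQ, hZmim, fun p hp => ?_, fun q hq => ?_, fun p hp => ?_, fun q hq => ?_⟩
  · rw [LinearMap.sub_apply, LinearMap.sub_apply, hZpP p hp, hZmP p hp]; module
  · rw [LinearMap.sub_apply, LinearMap.sub_apply, hZmQ q hq, hZpQ q hq]; module
  · rw [LinearMap.sub_apply, LinearMap.sub_apply, hZpP p hp, hZmP p hp, sub_zero]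
    have h : Z p - (2 : ℂ)⁻¹ • (Z p - T (Z p)) = (2 : ℂ)⁻¹ • (Z p + T (Z p)) := by module
    rw [h]; exact hPmem _
  · rw [LinearMap.sub_apply, LinearMap.sub_apply, hZmQ q hq, hZpQ q hq, sub_zero]
    have h : Z q - (2 : ℂ)⁻¹ • (Z q + T (Z q)) = (2 : ℂ)⁻¹ • (Z q - T (Z q)) := by module
    rw [h]; exact hQmem _

/-- **The symmetrized pairing of a bracket**: for `ω` alternating and `Z`, `B` skew,
`ω([Z, B] x, y) = ω(Z B x, y) + ω(Z B y, x)`. [cite: GoodmanWallachGTM255, §2.1.2] -/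
theorem SymplecticTheta.form_commutator_apply (ω : LinearMap.BilinForm ℂ M) (hωalt : ∀ x y, ω x y = -ω y x)
    {Z B : Module.End ℂ M} (hZ : ∀ x y, ω (Z x) y + ω x (Z y) = 0) (hB : ∀ x y, ω (B x) y + ω x (B y) = 0)
    (x y : M) : ω ((Z * B - B * Z) x) y = ω (Z (B x)) y + ω (Z (B y)) x := by
  rw [LinearMap.sub_apply, Module.End.mul_apply, Module.End.mul_apply, map_sub, LinearMap.sub_apply]
  have h1 := hB (Z x) y
  have h2 := hZ x (B y)
  have h3 := hωalt x (Z (B y))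
  linear_combination -h1 + h2 - h3

/-- **The core theorem.** Let `ω` be a nondegenerate alternating form on a complex space `M`, `𝔊 ⊆ End(M)` a
bracket-closed subspace of `ω`-skew operators containing an involution `T` (`T² = 1`) with eigenspaces
`P = ker(T − 1)`, `Q = ker(T + 1)` of dimension `2` (automatically Lagrangian and `ω`-dual), and suppose `M`
has no `𝔊`-stable subspace other than `0` and `M`. Then (A) every `ω`-skew `Y` with `Y(P) = 0`, `Y(M) ⊆ P`
lies in `𝔊` and (B) every `ω`-skew `Y` with `Y(P) ⊆ P`, `Y(Q) ⊆ Q` lies in `𝔊` — i.e. `𝔊 ⊇ 𝔲⁺ ⊕ 𝔤𝔩(P)`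
in the Siegel block form `𝔰𝔭(M, ω) = 𝔲⁻ ⊕ 𝔤𝔩(P) ⊕ 𝔲⁺` of Goodman–Wallach §2.1.2. Proof: module docstring, §1.
(Moonen–Zarhin (2.2): for an abelian surface with `End⁰ = ℚ`, "`Hg(X) = Sp(V,φ) ≅ Sp_{4,ℚ}`" — this is its
Lie-algebra mechanism, applied in §3 to `T = ±Θ`.) [cite: MoonenZarhin1999LowDim, §2 (2.2) and (1.8)]
[cite: GoodmanWallachGTM255, §2.1.2] [cite: Humphreys1972, §4.1 (Lie's theorem)] -/
theorem SymplecticTheta.core_of_irreducible [FiniteDimensional ℂ M] (ω : LinearMap.BilinForm ℂ M)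
    (hωnd : ω.Nondegenerate) (hωalt : ∀ x y, ω x y = -ω y x) (𝔊 : Submodule ℂ (Module.End ℂ M))
    (hbr : ∀ Y ∈ 𝔊, ∀ Z ∈ 𝔊, Y * Z - Z * Y ∈ 𝔊) (hskew : ∀ Z ∈ 𝔊, ∀ x y, ω (Z x) y + ω x (Z y) = 0)
    {T : Module.End ℂ M} (hT𝔊 : T ∈ 𝔊) (hTT : ∀ v, T (T v) = v) {P Q : Submodule ℂ M}
    (hP : ∀ x ∈ P, T x = x) (hQ : ∀ x ∈ Q, T x = -x) (hPmem : ∀ v, (2 : ℂ)⁻¹ • (v + T v) ∈ P)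
    (hQmem : ∀ v, (2 : ℂ)⁻¹ • (v - T v) ∈ Q) (hP2 : Module.finrank ℂ P = 2) (hQ2 : Module.finrank ℂ Q = 2)
    (hirr : ∀ U : Submodule ℂ M, (∀ Z ∈ 𝔊, ∀ u ∈ U, Z u ∈ U) → U = ⊥ ∨ U = ⊤) :
    (∀ Y : Module.End ℂ M, (∀ x y, ω (Y x) y + ω x (Y y) = 0) → (∀ p ∈ P, Y p = 0) → (∀ v, Y v ∈ P) →
      Y ∈ 𝔊) ∧
    (∀ Y : Module.End ℂ M, (∀ x y, ω (Y x) y + ω x (Y y) = 0) → (∀ p ∈ P, Y p ∈ P) → (∀ q ∈ Q, Y q ∈ Q) →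
      Y ∈ 𝔊) := by
  classical
  -- basic facts on `T`, `P`, `Q`
  have hPQv : ∀ v, (2 : ℂ)⁻¹ • (v + T v) + (2 : ℂ)⁻¹ • (v - T v) = v := fun v => by module
  have hPQ0 : ∀ x ∈ P, x ∈ Q → x = 0 := fun x hxP hxQ => by
    have h1 := hP x hxP
    rw [hQ x hxQ, neg_eq_iff_add_eq_zero, ← two_smul ℂ x, smul_eq_zero] at h1
    exact h1.resolve_left (two_ne_zero' ℂ)
  have hTskew := hskew T hT𝔊
  have hPiso : ∀ x ∈ P, ∀ y ∈ P, ω x y = 0 := fun x hx y hy => by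
    have h := hTskew x y
    rw [hP x hx, hP y hy] at h
    exact add_self_eq_zero.1 h
  have hQiso : ∀ x ∈ Q, ∀ y ∈ Q, ω x y = 0 := fun x hx y hy => by
    have h := hTskew x y
    rw [hQ x hx, hQ y hy, map_neg, LinearMap.neg_apply, map_neg, ← neg_add, neg_eq_zero, add_self_eq_zero] at h
    exact h
  have hdetP : ∀ x ∈ P, (∀ q ∈ Q, ω x q = 0) → x = 0 := fun x hx h =>
    hωnd.1 x fun y => by
      rw [← hPQv y, map_add, hPiso x hx _ (hPmem y), h _ (hQmem y), add_zero]
  have hdetQ : ∀ y ∈ Q, (∀ p ∈ P, ω p y = 0) → y = 0 := fun y hy h =>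
    hωnd.2 y fun x => by
      rw [← hPQv x, map_add, LinearMap.add_apply, h _ (hPmem x), hQiso _ (hQmem x) y hy, add_zero]
  have hext : ∀ Y Y' : Module.End ℂ M, (∀ p ∈ P, Y p = Y' p) → (∀ q ∈ Q, Y q = Y' q) → Y = Y' :=
    fun Y Y' h1 h2 => LinearMap.ext fun v => by
      rw [← hPQv v, map_add, map_add, h1 _ (hPmem v), h2 _ (hQmem v)]
  -- the grading of `𝔊`
  have hdec := fun Z (hZ : Z ∈ 𝔊) => SymplecticTheta.exists_decomp 𝔊 hbr hT𝔊 hTT hP hQ hPmem hQmem hZ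
  -- the Lie algebra `𝔩` of restrictions to the plane `P`
  let 𝔩 : Submodule ℂ (Module.End ℂ ↥P) :=
    { carrier := {A | ∃ Z ∈ 𝔊, ∀ p : ↥P, ((A p : ↥P) : M) = Z p}
      zero_mem' := ⟨0, Submodule.zero_mem _, fun p => by simp⟩
      add_mem' := by
        rintro A A' ⟨Z, hZ, hAZ⟩ ⟨Z', hZ', hAZ'⟩
        exact ⟨Z + Z', Submodule.add_mem _ hZ hZ', fun p => by
          rw [LinearMap.add_apply, Submodule.coe_add, hAZ, hAZ', LinearMap.add_apply]⟩
      smul_mem' := by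
        rintro c A ⟨Z, hZ, hAZ⟩
        exact ⟨c • Z, Submodule.smul_mem _ _ hZ, fun p => by
          rw [LinearMap.smul_apply, Submodule.coe_smul, hAZ, LinearMap.smul_apply]⟩ }
  have hmem𝔩 : ∀ A, A ∈ 𝔩 ↔ ∃ Z ∈ 𝔊, ∀ p : ↥P, ((A p : ↥P) : M) = Z p := fun A => Iff.rfl
  have h𝔩br : ∀ A ∈ 𝔩, ∀ A' ∈ 𝔩, A * A' - A' * A ∈ 𝔩 := by
    intro A hA A' hA'
    obtain ⟨Z, hZ, hAZ⟩ := (hmem𝔩 A).1 hA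
    obtain ⟨Z', hZ', hAZ'⟩ := (hmem𝔩 A').1 hA'
    refine (hmem𝔩 _).2 ⟨Z * Z' - Z' * Z, hbr _ hZ _ hZ', fun p => ?_⟩
    rw [LinearMap.sub_apply, Submodule.coe_sub, Module.End.mul_apply, Module.End.mul_apply, hAZ, hAZ', hAZ', hAZ,
      LinearMap.sub_apply, Module.End.mul_apply, Module.End.mul_apply]
  have h𝔩1 : (1 : Module.End ℂ ↥P) ∈ 𝔩 :=
    (hmem𝔩 _).2 ⟨T, hT𝔊, fun p => by rw [Module.End.one_apply, hP p p.2]⟩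
  -- restrictions of elements of `𝔊₀` lie in `𝔩`
  have hres : ∀ Z ∈ 𝔊, (hZP : ∀ p ∈ P, Z p ∈ P) → Z.restrict hZP ∈ 𝔩 := fun Z hZ hZP =>
    (hmem𝔩 _).2 ⟨Z, hZ, fun p => rfl⟩
  -- no `𝔩`-stable line: the orbit argument
  have h𝔩irr : ∀ U : Submodule ℂ ↥P, (∀ A ∈ 𝔩, ∀ u ∈ U, A u ∈ U) → U = ⊥ ∨ U = ⊤ := by
    intro U hU
    by_contra hcon
    push Not at hcon
    obtain ⟨hU0, hU1⟩ := hcon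
    obtain ⟨e, heU, he0⟩ := (Submodule.ne_bot_iff U).1 hU0
    have he0' : (e : M) ≠ 0 := fun h => he0 (Subtype.ext h)
    -- `U = ℂ e`
    have hUfin : Module.finrank ℂ U = 1 := by
      have h1 : 0 < Module.finrank ℂ U :=
        Module.finrank_pos_iff_exists_ne_zero.2 ⟨⟨e, heU⟩, fun h => he0 (congrArg Subtype.val h)⟩
      have h2 : Module.finrank ℂ U < Module.finrank ℂ (⊤ : Submodule ℂ ↥P) :=
        Submodule.finrank_lt_finrank_of_lt (lt_top_iff_ne_top.2 hU1)
      rw [finrank_top] at h2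
      omega
    have hUe : ∀ u ∈ U, ∃ c : ℂ, (u : M) = c • (e : M) := fun u hu => by
      obtain ⟨c, hc⟩ := (finrank_eq_one_iff_of_nonzero' (⟨e, heU⟩ : U) (fun h => he0 (congrArg Subtype.val h))).1
        hUfin ⟨u, hu⟩
      refine ⟨c, ?_⟩
      have h := congrArg (fun x : U => ((x : ↥P) : M)) hc
      simpa using h.symm
    -- every `Z ∈ 𝔊₀` has `Z e ∈ ℂ e`
    have hline : ∀ Z ∈ 𝔊, (∀ p ∈ P, Z p ∈ P) → ∃ c : ℂ, Z e = c • (e : M) := by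
      intro Z hZ hZP
      obtain ⟨c, hc⟩ := hUe _ (hU _ (hres Z hZ hZP) e heU)
      exact ⟨c, by rw [← hc]; rfl⟩
    -- a vector of `P` off the line
    obtain ⟨p₂, hp₂⟩ : ∃ p₂ : ↥P, p₂ ∉ U := by
      by_contra h
      push Not at h
      exact hU1 (eq_top_iff.2 fun x _ => h x)
    -- the orbit `U' = ℂ e + 𝔊₋ e`
    set S : Set M := {x | ∃ C ∈ 𝔊, (∀ q ∈ Q, C q = 0) ∧ (∀ v, C v ∈ Q) ∧ x = C e} with hS
    set U' : Submodule ℂ M := Submodule.span ℂ (insert (e : M) S) with hU'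
    have heU' : (e : M) ∈ U' := Submodule.subset_span (Set.mem_insert _ _)
    have hSU' : ∀ C ∈ 𝔊, (∀ q ∈ Q, C q = 0) → (∀ v, C v ∈ Q) → C e ∈ U' := fun C hC h1 h2 =>
      Submodule.subset_span (Set.mem_insert_of_mem _ ⟨C, hC, h1, h2, rfl⟩)
    have hU'stab : ∀ Z ∈ 𝔊, ∀ x ∈ U', Z x ∈ U' := by
      intro Z hZ x hx
      obtain ⟨Zm, hZm, Z0, hZ0, Zp, hZp, hZeq, hZpP, hZpim, hZmQ, hZmim, -, -, hZ0P, hZ0Q⟩ := hdec Z hZ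
      induction hx using Submodule.span_induction with
      | mem y hy =>
        rcases hy with rfl | ⟨C, hC, hCQ, hCim, rfl⟩
        · -- `Z e = Z₋ e + Z₀ e + Z₊ e = Z₋ e + c e + 0`
          obtain ⟨c, hc⟩ := hline Z0 hZ0 hZ0P
          rw [hZeq, LinearMap.add_apply, LinearMap.add_apply, hZpP _ e.2, add_zero, hc]
          exact Submodule.add_mem _ (hSU' Zm hZm hZmQ hZmim) (Submodule.smul_mem _ _ heU')
        · -- `Z (C e) = 0 + ([Z₀, C] e + C Z₀ e) + [Z₊, C] e`
          have h1 : Zm (C e) = 0 := hZmQ _ (hCim _)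
          have h2 : Z0 (C e) = (Z0 * C - C * Z0) e + C (Z0 e) := by
            rw [LinearMap.sub_apply, Module.End.mul_apply, Module.End.mul_apply, sub_add_cancel]
          have h3 : Zp (C e) = (Zp * C - C * Zp) e := by
            rw [LinearMap.sub_apply, Module.End.mul_apply, Module.End.mul_apply, hZpP _ e.2, map_zero, sub_zero]
          obtain ⟨c, hc⟩ := hline Z0 hZ0 hZ0P
          have hbr1 : Z0 * C - C * Z0 ∈ 𝔊 := hbr _ hZ0 _ hC
          have hbr1Q : ∀ q ∈ Q, (Z0 * C - C * Z0) q = 0 := fun q hq => by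
            rw [LinearMap.sub_apply, Module.End.mul_apply, Module.End.mul_apply, hCQ q hq, map_zero,
              hCQ _ (hZ0Q q hq), sub_zero]
          have hbr1im : ∀ v, (Z0 * C - C * Z0) v ∈ Q := fun v => by
            rw [LinearMap.sub_apply, Module.End.mul_apply, Module.End.mul_apply]
            exact Submodule.sub_mem _ (hZ0Q _ (hCim v)) (hCim _)
          have hbr2 : Zp * C - C * Zp ∈ 𝔊 := hbr _ hZp _ hC
          have hbr2P : ∀ p ∈ P, (Zp * C - C * Zp) p ∈ P := fun p hp => by
            rw [LinearMap.sub_apply, Module.End.mul_apply, Module.End.mul_apply, hZpP p hp, map_zero, sub_zero]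
            exact hZpim _
          obtain ⟨c', hc'⟩ := hline _ hbr2 hbr2P
          rw [hZeq, LinearMap.add_apply, LinearMap.add_apply, h1, zero_add, h2, h3, hc, map_smul, hc']
          exact Submodule.add_mem _ (Submodule.add_mem _ (hSU' _ hbr1 hbr1Q hbr1im)
            (Submodule.smul_mem _ _ (hSU' C hC hCQ hCim))) (Submodule.smul_mem _ _ heU')
      | zero => rw [map_zero]; exact Submodule.zero_mem _
      | add y y' _ _ hy hy' => rw [map_add]; exact Submodule.add_mem _ hy hy'
      | smul c y _ hy => rw [map_smul]; exact Submodule.smul_mem _ _ hy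
    rcases hirr U' hU'stab with h | h
    · exact he0' ((Submodule.mem_bot ℂ).1 (h ▸ heU'))
    · -- `U' = M`: but the `P`-components of `U'` lie on the line `ℂ e`
      set πP : Module.End ℂ M := (2 : ℂ)⁻¹ • (1 + T) with hπP
      have hπPapply : ∀ v, πP v = (2 : ℂ)⁻¹ • (v + T v) := fun v => rfl
      have hle : U' ≤ (ℂ ∙ (e : M)).comap πP := by
        rw [hU', Submodule.span_le]
        intro y hy
        rw [SetLike.mem_coe, Submodule.mem_comap, hπPapply]
        rcases hy with rfl | ⟨C, hC, hCQ, hCim, rfl⟩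
        · rw [hP _ e.2, ← two_smul ℂ (e : M), smul_smul, inv_mul_cancel₀ (two_ne_zero' ℂ), one_smul]
          exact Submodule.mem_span_singleton_self _
        · rw [hQ _ (hCim _), add_neg_cancel, smul_zero]
          exact Submodule.zero_mem _
      have hp₂U' : ((p₂ : ↥P) : M) ∈ U' := h ▸ Submodule.mem_top
      have hp₂e := hle hp₂U'
      rw [Submodule.mem_comap, hπPapply, hP _ p₂.2, ← two_smul ℂ ((p₂ : ↥P) : M), smul_smul,
        inv_mul_cancel₀ (two_ne_zero' ℂ), one_smul, Submodule.mem_span_singleton] at hp₂e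
      obtain ⟨c, hc⟩ := hp₂e
      apply hp₂
      have hp₂eq : p₂ = c • e := Subtype.ext (by rw [Submodule.coe_smul, hc])
      rw [hp₂eq]
      exact Submodule.smul_mem _ _ heU
  -- the plane lemma: `𝔩 = End(P)`
  have h𝔩top : 𝔩 = ⊤ := QuarticTheta.eq_top_of_forall_stable hP2 𝔩 h𝔩br h𝔩1 h𝔩irr
  -- realisation of an arbitrary endomorphism of `P` by an element of `𝔊₀`
  have hreal : ∀ A : Module.End ℂ ↥P, ∃ Z ∈ 𝔊, (∀ (p : M) (hp : p ∈ P), Z p = ((A ⟨p, hp⟩ : ↥P) : M)) ∧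
      (∀ p ∈ P, Z p ∈ P) ∧ (∀ q ∈ Q, Z q ∈ Q) := by
    intro A
    have hA : A ∈ 𝔩 := h𝔩top ▸ Submodule.mem_top
    obtain ⟨Z, hZ, hAZ⟩ := (hmem𝔩 A).1 hA
    obtain ⟨Zm, hZm, Z0, hZ0, Zp, hZp, -, -, -, -, -, hZ0P', -, hZ0P, hZ0Q⟩ := hdec Z hZ
    refine ⟨Z0, hZ0, fun p hp => ?_, hZ0P, hZ0Q⟩
    have hZp : Z p ∈ P := by rw [← hAZ ⟨p, hp⟩]; exact (A ⟨p, hp⟩).2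
    rw [hZ0P' p hp, hP _ hZp, ← two_smul ℂ (Z p), smul_smul, inv_mul_cancel₀ (two_ne_zero' ℂ), one_smul,
      hAZ ⟨p, hp⟩]
  -- (B) the Levi part
  have hB : ∀ Y : Module.End ℂ M, (∀ x y, ω (Y x) y + ω x (Y y) = 0) → (∀ p ∈ P, Y p ∈ P) →
      (∀ q ∈ Q, Y q ∈ Q) → Y ∈ 𝔊 := by
    intro Y hYskew hYP hYQ
    obtain ⟨Z, hZ, hZY, -, hZQ⟩ := hreal (Y.restrict hYP)
    have hZP' : ∀ p ∈ P, Z p = Y p := fun p hp => by rw [hZY p hp]; rfl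
    have hZQ' : ∀ q ∈ Q, Z q = Y q := by
      intro q hq
      rw [← sub_eq_zero, ← LinearMap.sub_apply]
      refine hdetQ _ (Submodule.sub_mem _ (hZQ q hq) (hYQ q hq)) fun p hp => ?_
      have h1 := hskew Z hZ p q
      have h2 := hYskew p q
      rw [LinearMap.sub_apply, map_sub]
      have h3 : ω (Z p) q = ω (Y p) q := by rw [hZP' p hp]
      linear_combination h1 - h2 - h3
    rw [← hext Z Y hZP' hZQ']
    exact hZ
  refine ⟨?_, hB⟩
  -- (A) the unipotent part
  intro Y hYskew hYP hYim
  -- `𝔊₊ ≠ 0`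
  obtain ⟨B, hB𝔊, hBP, hBim, hB0⟩ : ∃ B ∈ 𝔊, (∀ p ∈ P, B p = 0) ∧ (∀ v, B v ∈ P) ∧ B ≠ 0 := by
    by_contra hcon
    push Not at hcon
    have hQstab : ∀ Z ∈ 𝔊, ∀ q ∈ Q, Z q ∈ Q := by
      intro Z hZ q hq
      obtain ⟨Zm, hZm, Z0, hZ0, Zp, hZp, hZeq, hZpP, hZpim, hZmQ, -, -, -, -, hZ0Q⟩ := hdec Z hZ
      rw [hZeq, LinearMap.add_apply, LinearMap.add_apply, hZmQ q hq, zero_add, hcon Zp hZp hZpP hZpim,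
        LinearMap.zero_apply, add_zero]
      exact hZ0Q q hq
    rcases hirr Q hQstab with h | h
    · rw [h, finrank_bot] at hQ2
      exact two_ne_zero hQ2.symm
    · have hPbot : P = ⊥ := by
        rw [eq_bot_iff]
        intro x hx
        rw [Submodule.mem_bot]
        exact hPQ0 x hx (h ▸ Submodule.mem_top)
      rw [hPbot, finrank_bot] at hP2
      exact two_ne_zero hP2.symm
  -- brackets `[Z, B]` with `Z ∈ 𝔊₀`: again in `𝔊₊`, with the symmetrized pairing
  have hbrk : ∀ B ∈ 𝔊, (∀ p ∈ P, B p = 0) → (∀ v, B v ∈ P) → ∀ Z ∈ 𝔊, (∀ p ∈ P, Z p ∈ P) →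
      (Z * B - B * Z) ∈ 𝔊 ∧ (∀ p ∈ P, (Z * B - B * Z) p = 0) ∧ (∀ v, (Z * B - B * Z) v ∈ P) ∧
        ∀ x y, ω ((Z * B - B * Z) x) y = ω (Z (B x)) y + ω (Z (B y)) x := by
    intro B hB𝔊 hBP hBim Z hZ hZP
    refine ⟨hbr _ hZ _ hB𝔊, fun p hp => ?_, fun v => ?_,
      SymplecticTheta.form_commutator_apply ω hωalt (hskew Z hZ) (hskew B hB𝔊)⟩
    · rw [LinearMap.sub_apply, Module.End.mul_apply, Module.End.mul_apply, hBP p hp, map_zero,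
        hBP _ (hZP p hp), sub_zero]
    · rw [LinearMap.sub_apply, Module.End.mul_apply, Module.End.mul_apply]
      exact Submodule.sub_mem _ (hZP _ (hBim v)) (hBim _)
  -- an element of `𝔊₊` injective on `Q`
  obtain ⟨B, hB𝔊, hBP, hBim, hBinj⟩ : ∃ B ∈ 𝔊, (∀ p ∈ P, B p = 0) ∧ (∀ v, B v ∈ P) ∧
      ∀ q ∈ Q, B q = 0 → q = 0 := by
    by_cases hBi : ∀ q ∈ Q, B q = 0 → q = 0
    · exact ⟨B, hB𝔊, hBP, hBim, hBi⟩
    push Not at hBi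
    obtain ⟨q₀, hq₀Q, hBq₀, hq₀0⟩ := hBi
    -- a vector `q₁ ∈ Q` with `u = B q₁ ≠ 0`
    obtain ⟨v, hv⟩ : ∃ v, B v ≠ 0 := by
      by_contra h
      push Not at h
      exact hB0 (LinearMap.ext h)
    set q₁ := (2 : ℂ)⁻¹ • (v - T v) with hq₁
    have hq₁Q : q₁ ∈ Q := hQmem v
    have hBq₁ : B q₁ = B v := by
      conv_rhs => rw [← hPQv v]
      rw [map_add, hBP _ (hPmem v), zero_add]
    set u := B q₁ with hu
    have hu0 : u ≠ 0 := by rw [hBq₁]; exact hv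
    have huP : u ∈ P := hBim _
    -- `Q = ℂ q₀ + ℂ q₁`, so `B(Q) = ℂ u`
    have hq₁0 : q₁ ∉ (ℂ ∙ q₀) := by
      intro h
      obtain ⟨c, hc⟩ := Submodule.mem_span_singleton.1 h
      apply hu0
      rw [hu, ← hc, map_smul, hBq₀, smul_zero]
    have hQspan := SymplecticTheta.exists_pair_of_finrank_two hQ2 hq₀Q hq₁Q hq₀0 hq₁0
    have hBQ : ∀ q ∈ Q, ∃ b : ℂ, B q = b • u := fun q hq => by
      obtain ⟨a, b, rfl⟩ := hQspan q hq
      exact ⟨b, by rw [map_add, map_smul, map_smul, hBq₀, smul_zero, zero_add]⟩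
    -- a vector `w ∈ P` off the line `ℂ u`, and `ω(w, q₀) ≠ 0`
    obtain ⟨w, hwP, hwu⟩ : ∃ w ∈ P, w ∉ (ℂ ∙ u) := by
      by_contra h
      push Not at h
      have hle : P ≤ (ℂ ∙ u) := fun x hx => h x hx
      have h1 := Submodule.finrank_mono hle
      have h2 := finrank_span_singleton (K := ℂ) hu0
      rw [hP2, h2] at h1
      omega
    have hPspan := SymplecticTheta.exists_pair_of_finrank_two hP2 huP hwP hu0 hwu
    have huq₀ : ω u q₀ = 0 := by
      have h := hskew B hB𝔊 q₁ q₀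
      rwa [hBq₀, map_zero, add_zero] at h
    have hwq₀ : ω w q₀ ≠ 0 := by
      intro h0
      apply hq₀0
      refine hdetQ q₀ hq₀Q fun p hp => ?_
      obtain ⟨a, b, rfl⟩ := hPspan p hp
      rw [map_add, map_smul, map_smul, LinearMap.add_apply, LinearMap.smul_apply, LinearMap.smul_apply, huq₀, h0,
        smul_zero, smul_zero, add_zero]
    -- an element `Z ∈ 𝔊₀` with `Z u = w`
    obtain ⟨f, hf⟩ := Module.Projective.exists_dual_ne_zero ℂ (show (⟨u, huP⟩ : ↥P) ≠ 0 from
      fun h => hu0 (congrArg Subtype.val h))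
    set A : Module.End ℂ ↥P := (f ⟨u, huP⟩)⁻¹ • LinearMap.smulRight f ⟨w, hwP⟩ with hA
    have hAu : ((A ⟨u, huP⟩ : ↥P) : M) = w := by
      rw [hA, LinearMap.smul_apply, LinearMap.smulRight_apply, smul_smul, inv_mul_cancel₀ hf, one_smul]
    obtain ⟨Z, hZ, hZA, hZP, -⟩ := hreal A
    have hZu : Z u = w := by rw [hZA u huP, hAu]
    obtain ⟨hB'𝔊, hB'P, hB'im, hB'ω⟩ := hbrk B hB𝔊 hBP hBim Z hZ hZP
    refine ⟨Z * B - B * Z, hB'𝔊, hB'P, hB'im, fun q hq hq0 => ?_⟩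
    -- injectivity on `Q`
    obtain ⟨b, hb⟩ := hBQ q hq
    have key : ∀ q' ∈ Q, ω (Z (B q)) q' + ω (Z (B q')) q = 0 := fun q' hq' => by
      rw [← hB'ω, hq0, map_zero, LinearMap.zero_apply]
    have hb0 : b = 0 := by
      have h := key q₀ hq₀Q
      rw [hBq₀, map_zero, map_zero, LinearMap.zero_apply, add_zero, hb, map_smul, hZu, map_smul,
        LinearMap.smul_apply, smul_eq_mul, mul_eq_zero] at h
      exact h.resolve_right hwq₀
    have hBq : B q = 0 := by rw [hb, hb0, zero_smul]
    have hwq : ω w q = 0 := by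
      have h := key q₁ hq₁Q
      rwa [hBq, map_zero, map_zero, LinearMap.zero_apply, zero_add, hZu] at h
    have huq : ω u q = 0 := by
      have h := hskew B hB𝔊 q₁ q
      rwa [hBq, map_zero, add_zero] at h
    refine hdetQ q hq fun p hp => ?_
    obtain ⟨a, c, rfl⟩ := hPspan p hp
    rw [map_add, map_smul, map_smul, LinearMap.add_apply, LinearMap.smul_apply, LinearMap.smul_apply, huq, hwq,
      smul_zero, smul_zero, add_zero]
  -- `B : Q → P` is bijective; `A = ½ Y B⁻¹` on `P`
  set β : ↥Q →ₗ[ℂ] ↥P := LinearMap.codRestrict P (B ∘ₗ Q.subtype) (fun q => hBim _) with hβ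
  have hβinj : Function.Injective β := by
    intro q q' h
    apply Subtype.ext
    rw [← sub_eq_zero]
    refine hBinj _ (Submodule.sub_mem _ q.2 q'.2) ?_
    have h' := congrArg Subtype.val h
    simp only [hβ, LinearMap.codRestrict_apply, LinearMap.comp_apply, Submodule.subtype_apply] at h'
    rw [map_sub, h', sub_self]
  have hβbij : Function.Bijective β :=
    ⟨hβinj, (LinearMap.injective_iff_surjective_of_finrank_eq_finrank (by rw [hQ2, hP2])).1 hβinj⟩
  set βe := LinearEquiv.ofBijective β hβbij with hβe
  set γ : ↥Q →ₗ[ℂ] ↥P := LinearMap.codRestrict P (Y ∘ₗ Q.subtype) (fun q => hYim _) with hγ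
  set A : Module.End ℂ ↥P := (2 : ℂ)⁻¹ • (γ ∘ₗ βe.symm.toLinearMap) with hA
  have hAB : ∀ (q : M) (hq : q ∈ Q), ((A ⟨B q, hBim q⟩ : ↥P) : M) = (2 : ℂ)⁻¹ • Y q := by
    intro q hq
    have h1 : (⟨B q, hBim q⟩ : ↥P) = βe ⟨q, hq⟩ := by
      rw [hβe, LinearEquiv.ofBijective_apply]; rfl
    rw [h1, hA, LinearMap.smul_apply, LinearMap.comp_apply, LinearEquiv.coe_toLinearMap,
      LinearEquiv.symm_apply_apply, Submodule.coe_smul]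
    rfl
  obtain ⟨Z, hZ, hZA, hZP, -⟩ := hreal A
  have hZB : ∀ q ∈ Q, Z (B q) = (2 : ℂ)⁻¹ • Y q := fun q hq => by rw [hZA _ (hBim q), hAB q hq]
  obtain ⟨hB'𝔊, hB'P, -, hB'ω⟩ := hbrk B hB𝔊 hBP hBim Z hZ hZP
  -- `[Z, B] = Y`
  have hYQ : ∀ q ∈ Q, (Z * B - B * Z) q = Y q := by
    intro q hq
    rw [← sub_eq_zero, ← LinearMap.sub_apply]
    refine hdetP _ (Submodule.sub_mem _ ?_ (hYim q)) fun q' hq' => ?_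
    · rw [LinearMap.sub_apply, Module.End.mul_apply, Module.End.mul_apply]
      exact Submodule.sub_mem _ (hZP _ (hBim q)) (hBim _)
    rw [LinearMap.sub_apply, map_sub, LinearMap.sub_apply, hB'ω, hZB q hq, hZB q' hq', map_smul, map_smul,
      LinearMap.smul_apply, LinearMap.smul_apply]
    have h1 := hYskew q' q
    have h2 := hωalt q' (Y q)
    rw [smul_eq_mul, smul_eq_mul]
    linear_combination (2 : ℂ)⁻¹ * h1 - (2 : ℂ)⁻¹ * h2
  have hYeq : Z * B - B * Z = Y := hext _ _ (fun p hp => by rw [hB'P p hp, hYP p hp]) hYQ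
  rw [← hYeq]
  exact hB'𝔊

end Core

/-! ### §2 Irreducibility of `V_ℂ` under an admissible `𝔤` when `End_Hdg(V) = ℚ` -/

section Irreducible

universe u

variable {V : Type u} [AddCommGroup V] [Module ℚ V] {n : ℤ}

/-- `E_ℂ = ℂ`: an element of the complex span of `{a_ℂ : a ∈ End_Hdg(V)}` is a scalar when `End_Hdg(V) = ℚ`.
[cite: MoonenZarhin1999LowDim, §2 (2.2)] -/
theorem SymplecticTheta.exists_eq_smul_one_of_mem_span_endAlg (H : HodgeStructure V n)
    (hE : ∀ a ∈ H.endAlg, ∃ x : ℚ, a = x • 1) {T : Module.End ℂ (ℂ ⊗[ℚ] V)}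
    (hT : T ∈ Submodule.span ℂ ((fun a : Module.End ℚ V => a.baseChange ℂ) '' (H.endAlg : Set _))) :
    ∃ α : ℂ, T = α • 1 := by
  induction hT using Submodule.span_induction with
  | mem Z hZ =>
    obtain ⟨a, ha, rfl⟩ := hZ
    obtain ⟨x, hx⟩ := hE a ha
    refine ⟨x, ?_⟩
    dsimp only
    rw [hx, LinearMap.baseChange_smul, LinearMap.baseChange_one]
    refine LinearMap.ext fun v => ?_
    rw [LinearMap.smul_apply, LinearMap.smul_apply, Module.End.one_apply, ← algebraMap_smul ℂ x v, eq_ratCast]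
  | zero => exact ⟨0, by rw [zero_smul]⟩
  | add Z Z' _ _ hZ hZ' =>
    obtain ⟨α, rfl⟩ := hZ
    obtain ⟨α', rfl⟩ := hZ'
    exact ⟨α + α', by rw [add_smul]⟩
  | smul c Z _ hZ =>
    obtain ⟨α, rfl⟩ := hZ
    exact ⟨c * α, by rw [smul_smul]⟩

/-- **Irreducibility of `V_ℂ` under `𝔤` when `End_Hdg(V) = ℚ`.** Let `H` be an effective polarized weight-one
Hodge structure with `End_Hdg(V) = ℚ`, and `𝔤 ⊆ End_ℚ(V)` a `ℚ`-subspace of `ψ`-skew operators whose complex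
span contains a Hodge operator `Θ`. A subspace `U ⊆ V_ℂ` stable under the `X_ℂ`, `X ∈ 𝔤`, is `0` or `V_ℂ`:
`U` is `Θ`-graded; `U† = {y : ψ_ℂ(y, conj U) = 0}` is stable (the `X_ℂ` are real and skew) with `U ∩ U† = 0`
(second Hodge–Riemann relation on the graded pieces) and `dim U† ≥ dim V_ℂ − dim U`, so `V_ℂ = U ⊕ U†`;
the projector onto `U` commutes with `𝔤`, hence lies in `End_Hdg ⊗ ℂ = ℂ`
(`ThetaSubalgebra.mem_span_endAlg_of_forall_commute`) and is `0` or `1`. (The device of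
`UnitaryTheta.eq_bot_or_eq_of_stable`; Zarhin §2, Gordon §6.)
[cite: Zarhin1983HodgeGroupsK3, §2] [cite: Gordon1997, §6 (proof of Thm. 6.3.3, p. 19)]
[cite: VoisinHodgeI2002, §7.1.2 Def. 7.7] [cite: MoonenZarhin1999LowDim, §2 (2.2)] -/
theorem SymplecticTheta.eq_bot_or_top_of_stable [Module.Finite ℚ V] (H : HodgeStructure V n) (hn : n = 1)
    (heff : H.IsEffective) (ψ : H.Polarization) (hE : ∀ a ∈ H.endAlg, ∃ x : ℚ, a = x • 1)
    (𝔤 : Submodule ℚ (Module.End ℚ V)) {Θ : Module.End ℂ (ℂ ⊗[ℚ] V)}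
    (hΘ : ∀ p, ∀ x ∈ H.piece p (n - p), Θ x = ((2 * p - n : ℤ) : ℂ) • x) (hΘ𝔤 : Θ ∈ spanC 𝔤)
    (hskew : ∀ X ∈ 𝔤, ∀ v w, ψ.form (X v) w + ψ.form v (X w) = 0)
    {U : Submodule ℂ (ℂ ⊗[ℚ] V)} (hU : ∀ X ∈ 𝔤, ∀ u ∈ U, X.baseChange ℂ u ∈ U) : U = ⊥ ∨ U = ⊤ := by
  subst hn
  classical
  set ψC := ψ.form.baseChange ℂ with hψC
  -- the Hodge projectors `P = (1 + Θ)/2`, `Q = (1 - Θ)/2`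
  obtain ⟨hP, hQ, -, -, -⟩ := UnitaryTheta.theta_facts H rfl heff hΘ
  have hPQ : ∀ v, (2 : ℂ)⁻¹ • (v + Θ v) + (2 : ℂ)⁻¹ • (v - Θ v) = v := fun v => by module
  have hXskew : ∀ X ∈ 𝔤, ∀ x y, ψC (X.baseChange ℂ x) y + ψC x (X.baseChange ℂ y) = 0 :=
    fun X hX => ThetaSubalgebra.formBaseChange_add_eq_zero_of_skew ψ (hskew X hX)
  have hgraded : ∀ T : Submodule ℂ (ℂ ⊗[ℚ] V), (∀ X ∈ 𝔤, ∀ u ∈ T, X.baseChange ℂ u ∈ T) →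
      ∀ u ∈ T, (2 : ℂ)⁻¹ • (u + Θ u) ∈ T ∧ (2 : ℂ)⁻¹ • (u - Θ u) ∈ T := by
    intro T hT u hu
    have hΘu : Θ u ∈ T := mapsTo_of_mem_spanC (T := T) (fun X hX => fun u hu => hT X hX u hu) hΘ𝔤 hu
    exact ⟨Submodule.smul_mem _ _ (Submodule.add_mem _ hu hΘu),
      Submodule.smul_mem _ _ (Submodule.sub_mem _ hu hΘu)⟩
  by_cases hU0 : U = ⊥
  · exact Or.inl hU0
  right
  obtain ⟨u₀, hu₀U, hu₀0⟩ := (Submodule.ne_bot_iff U).1 hU0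
  -- `U† = {y : ψ_ℂ(y, conj U) = 0}`
  set Ud : Submodule ℂ (ℂ ⊗[ℚ] V) := ⨅ u : U, LinearMap.ker (ψC.flip (conj (u : ℂ ⊗[ℚ] V))) with hUddef
  have hmemUd : ∀ y, y ∈ Ud ↔ ∀ u ∈ U, ψC y (conj u) = 0 := fun y => by
    simp only [hUddef, Submodule.mem_iInf, LinearMap.mem_ker, Subtype.forall]
    exact Iff.rfl
  have hXUd : ∀ X ∈ 𝔤, ∀ y ∈ Ud, X.baseChange ℂ y ∈ Ud := by
    intro X hX y hy
    rw [hmemUd] at hy ⊢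
    intro u hu
    have h := hXskew X hX y (conj u)
    rwa [← conj_baseChange, hy _ (hU X hX u hu), add_zero] at h
  -- `U ∩ U† = 0`
  have hUUd : ∀ u ∈ U, u ∈ Ud → u = 0 := by
    intro u hu hud
    have key : ∀ z ∈ U, z ∈ Ud → ∀ p q : ℤ, p + q = 1 → z ∈ H.piece p q → z = 0 := by
      intro z hz hzd p q hpq hzpq
      by_contra hz0
      exact ψ.form_conj_ne_zero hpq hzpq hz0 (((hmemUd z).1 hzd) z hz)
    have h1 := key _ (hgraded U hU u hu).1 (hgraded Ud hXUd u hud).1 1 0 (by norm_num) (hP u)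
    have h2 := key _ (hgraded U hU u hu).2 (hgraded Ud hXUd u hud).2 0 1 (by norm_num) (hQ u)
    rw [← hPQ u, h1, h2, add_zero]
  -- `dim V_ℂ ≤ dim U + dim U†`
  have hdim : Module.finrank ℂ (ℂ ⊗[ℚ] V) ≤ Module.finrank ℂ U + Module.finrank ℂ Ud := by
    set b := Module.finBasis ℂ U with hbdef
    set f : (ℂ ⊗[ℚ] V) →ₗ[ℂ] (Fin (Module.finrank ℂ U) → ℂ) :=
      LinearMap.pi fun i => ψC.flip (conj (b i : ℂ ⊗[ℚ] V)) with hfdef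
    have hf : ∀ w i, f w i = ψC w (conj (b i : ℂ ⊗[ℚ] V)) := fun w i => rfl
    have hker : LinearMap.ker f ≤ Ud := by
      intro w hw
      rw [LinearMap.mem_ker] at hw
      rw [hmemUd]
      intro u hu
      have hu' : u = ∑ i, b.repr ⟨u, hu⟩ i • (b i : ℂ ⊗[ℚ] V) := by
        have h := congrArg Subtype.val (b.sum_repr ⟨u, hu⟩).symm
        simpa only [Submodule.coe_sum, Submodule.coe_smul] using h
      rw [hu', map_sum, map_sum]
      refine Finset.sum_eq_zero fun i _ => ?_
      have hi := congrFun hw i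
      rw [Pi.zero_apply, hf] at hi
      rw [conj_smul, map_smul, smul_eq_mul, hi, mul_zero]
    have h1 := LinearMap.finrank_range_add_finrank_ker f
    have h2 : Module.finrank ℂ (LinearMap.range f) ≤ Module.finrank ℂ U :=
      (Submodule.finrank_le _).trans (Module.finrank_fin_fun ℂ).le
    have h3 : Module.finrank ℂ (LinearMap.ker f) ≤ Module.finrank ℂ Ud := Submodule.finrank_mono hker
    omega
  -- `V_ℂ = U ⊕ U†`
  have h0 : U ⊓ Ud = ⊥ := by
    rw [eq_bot_iff]
    intro u hu
    rw [Submodule.mem_bot]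
    exact hUUd u hu.1 hu.2
  have hsup : U ⊔ Ud = ⊤ := by
    refine Submodule.eq_top_of_finrank_eq ?_
    have h := Submodule.finrank_sup_add_finrank_inf_eq U Ud
    rw [h0, finrank_bot, add_zero] at h
    have h' := Submodule.finrank_le (U ⊔ Ud)
    omega
  have hc : IsCompl U Ud := ⟨disjoint_iff.2 h0, codisjoint_iff.2 hsup⟩
  -- the projector onto `U` commutes with `𝔤`
  set π := U.projection Ud hc with hπ
  have hπcomm : ∀ X ∈ 𝔤, π * X.baseChange ℂ = X.baseChange ℂ * π := by
    intro X hX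
    refine LinearMap.ext fun x => ?_
    rw [Module.End.mul_apply, Module.End.mul_apply]
    have hx : x = π x + (x - π x) := by abel
    have h1 : π x ∈ U := Submodule.projection_apply_mem hc x
    have h2 : X.baseChange ℂ (x - π x) ∈ Ud := hXUd X hX _ (Submodule.sub_projection_mem hc x)
    conv_lhs => rw [hx]
    rw [map_add, map_add, Submodule.projection_apply_of_mem_left hc (hU X hX _ h1),
      (Submodule.projection_apply_eq_zero_iff hc).2 h2, add_zero]
  -- hence is a scalar, equal to `1`
  obtain ⟨α, hπα⟩ := SymplecticTheta.exists_eq_smul_one_of_mem_span_endAlg H hE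
    (ThetaSubalgebra.mem_span_endAlg_of_forall_commute H 𝔤 hΘ hΘ𝔤 hπcomm)
  have hα : α = 1 := by
    have h : π u₀ = u₀ := Submodule.projection_apply_of_mem_left hc hu₀U
    rw [hπα, LinearMap.smul_apply, Module.End.one_apply] at h
    have h' : (α - 1) • u₀ = 0 := by rw [sub_smul, one_smul, h, sub_self]
    exact sub_eq_zero.1 ((smul_eq_zero.1 h').resolve_right hu₀0)
  rw [eq_top_iff]
  intro w _
  have h : π w ∈ U := Submodule.projection_apply_mem hc w
  rwa [hπα, hα, one_smul, Module.End.one_apply] at h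

end Irreducible

/-! ### §3 The theorem: `𝔤_ℂ = 𝔰𝔭(V, ψ)_ℂ`, `𝔤 = 𝔰𝔭(V, ψ) = Lie Hg(H)` -/

section Main

universe u

variable {V : Type u} [AddCommGroup V] [Module ℚ V] {n : ℤ}

/-- Skew operators are closed under the commutator. [cite: GoodmanWallachGTM255, §2.1.2] -/
private theorem SymplecticTheta.skew_commutator {M : Type*} [AddCommGroup M] [Module ℂ M]
    (ω : LinearMap.BilinForm ℂ M) {Y Z : Module.End ℂ M} (hY : ∀ x y, ω (Y x) y + ω x (Y y) = 0)
    (hZ : ∀ x y, ω (Z x) y + ω x (Z y) = 0) (x y : M) :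
    ω ((Y * Z - Z * Y) x) y + ω x ((Y * Z - Z * Y) y) = 0 := by
  simp only [LinearMap.sub_apply, Module.End.mul_apply, map_sub, LinearMap.sub_apply]
  have h1 := hY (Z x) y
  have h2 := hZ x (Y y)
  have h3 := hZ (Y x) y
  have h4 := hY x (Z y)
  linear_combination h1 - h3 + h4 - h2

/-- **The pieces `V^{1,0}` and `V^{0,1}` of an effective weight-one Hodge structure on a four-dimensional `V` are
planes** (`V_ℂ = V^{1,0} ⊕ V^{0,1}`, `h^{1,0} = h^{0,1}`). [cite: VoisinHodgeI2002, §7.1.1] -/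
theorem SymplecticTheta.finrank_pieces_eq_two [Module.Finite ℚ V] (H : HodgeStructure V n) (hn : n = 1)
    (heff : H.IsEffective) (hV : Module.finrank ℚ V = 4) {Θ : Module.End ℂ (ℂ ⊗[ℚ] V)}
    (hΘ : ∀ p, ∀ x ∈ H.piece p (n - p), Θ x = ((2 * p - n : ℤ) : ℂ) • x) :
    Module.finrank ℂ (H.piece 1 0) = 2 ∧ Module.finrank ℂ (H.piece 0 1) = 2 := by
  subst hn
  obtain ⟨hP, hQ, hΘ10, hΘ01, -⟩ := UnitaryTheta.theta_facts H rfl heff hΘ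
  have hPQ : ∀ v, (2 : ℂ)⁻¹ • (v + Θ v) + (2 : ℂ)⁻¹ • (v - Θ v) = v := fun v => by module
  have hsup : H.piece 1 0 ⊔ H.piece 0 1 = ⊤ := by
    rw [eq_top_iff]
    intro v _
    rw [← hPQ v]
    exact Submodule.add_mem_sup (hP v) (hQ v)
  have hinf : H.piece 1 0 ⊓ H.piece 0 1 = ⊥ := by
    rw [eq_bot_iff]
    intro x hx
    rw [Submodule.mem_bot]
    have h1 := hΘ10 x hx.1
    rw [hΘ01 x hx.2, neg_eq_iff_add_eq_zero, ← two_smul ℂ x, smul_eq_zero] at h1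
    exact h1.resolve_left (two_ne_zero' ℂ)
  have hsum := Submodule.finrank_sup_add_finrank_inf_eq (H.piece 1 0) (H.piece 0 1)
  rw [hsup, hinf, finrank_top, finrank_bot, add_zero, Module.finrank_baseChange, hV] at hsum
  have hsymm : Module.finrank ℂ (H.piece 1 0) = Module.finrank ℂ (H.piece 0 1) := hodgeNumber_symm_holds H 1 0
  omega

/-- **Theorem (`𝔤_ℂ = 𝔰𝔭(V, ψ)_ℂ` for a generic weight-one Hodge structure of rank four; the Lie step of
Moonen–Zarhin 1999 (2.2) Type I(1), `g = 2`, for an arbitrary admissible rational Lie algebra).** Let `H` be an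
effective polarized `ℚ`-Hodge structure of weight `1` with `dim V = 4` and `End_Hdg(V) = ℚ`. Let `𝔤 ⊆ End_ℚ(V)`
be a bracket-closed `ℚ`-subspace of `ψ`-skew operators whose complex span contains a Hodge operator `Θ`. Then
every `ψ_ℂ`-skew operator `Y` of `V_ℂ` lies in `𝔤_ℂ`. Proof: `V_ℂ` is `𝔤`-irreducible (§2); the core theorem
(§1) for `T = Θ` on `V^{1,0} ⊕ V^{0,1}` gives `𝔲⁺ ⊕ 𝔤𝔩(V^{1,0}) ⊆ 𝔤_ℂ`, and for `T = −Θ` gives `𝔲⁻ ⊆ 𝔤_ℂ`;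
`Y = Y₋ + Y₀ + Y₊` along `ad Θ`. (MZ99 (2.2): "Type 1(1): `X` is an abelian surface with `End⁰(X) = ℚ`. Then
`Hg(X) = Sp(V,φ) ≅ Sp_{4,ℚ}`.") [cite: MoonenZarhin1999LowDim, §2 (2.2) and (1.8)]
[cite: Gordon1997, §1.6.2 and Thm. 7.5] [cite: Deligne1982HodgeCycles, I §3 Prop. 3.4] -/
theorem SymplecticTheta.mem_spanC_of_skew [Module.Finite ℚ V] (H : HodgeStructure V n) (hn : n = 1)
    (heff : H.IsEffective) (ψ : H.Polarization) (hE : ∀ a ∈ H.endAlg, ∃ x : ℚ, a = x • 1)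
    (hV : Module.finrank ℚ V = 4) (𝔤 : Submodule ℚ (Module.End ℚ V))
    (hbr : ∀ X ∈ 𝔤, ∀ X' ∈ 𝔤, X * X' - X' * X ∈ 𝔤) {Θ : Module.End ℂ (ℂ ⊗[ℚ] V)}
    (hΘ : ∀ p, ∀ x ∈ H.piece p (n - p), Θ x = ((2 * p - n : ℤ) : ℂ) • x) (hΘ𝔤 : Θ ∈ spanC 𝔤)
    (hskew : ∀ X ∈ 𝔤, ∀ v w, ψ.form (X v) w + ψ.form v (X w) = 0) {Y : Module.End ℂ (ℂ ⊗[ℚ] V)}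
    (hYskew : ∀ x y, ψ.form.baseChange ℂ (Y x) y + ψ.form.baseChange ℂ x (Y y) = 0) : Y ∈ spanC 𝔤 := by
  have hfin := SymplecticTheta.finrank_pieces_eq_two H hn heff hV hΘ
  have hirr : ∀ U : Submodule ℂ (ℂ ⊗[ℚ] V), (∀ Z ∈ spanC 𝔤, ∀ u ∈ U, Z u ∈ U) → U = ⊥ ∨ U = ⊤ :=
    fun U hU => SymplecticTheta.eq_bot_or_top_of_stable H hn heff ψ hE 𝔤 hΘ hΘ𝔤 hskew
      fun X hX u hu => hU _ (baseChange_mem_spanC hX) u hu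
  subst hn
  obtain ⟨hP, hQ, hΘ10, hΘ01, hΘΘ⟩ := UnitaryTheta.theta_facts H rfl heff hΘ
  set ω := ψ.form.baseChange ℂ with hω
  have hωnd : ω.Nondegenerate := ψ.nondegenerate_baseChange
  have hωalt : ∀ x y, ω x y = -ω y x := fun x y => by
    rw [hω, ψ.form_baseChange_swap y x, Int.negOnePow_odd 1 odd_one]
    norm_num
  -- the complex Lie algebra `𝔊 = 𝔤_ℂ`
  have h𝔊br : ∀ Z ∈ spanC 𝔤, ∀ Z' ∈ spanC 𝔤, Z * Z' - Z' * Z ∈ spanC 𝔤 := fun Z hZ Z' hZ' =>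
    commutator_mem_spanC hbr hZ hZ'
  have h𝔊skew : ∀ Z ∈ spanC 𝔤, ∀ x y, ω (Z x) y + ω x (Z y) = 0 := fun Z hZ =>
    ThetaSubalgebra.formBaseChange_add_eq_zero_of_mem_spanC ψ hskew hZ
  have hnΘ𝔤 : -Θ ∈ spanC 𝔤 := Submodule.neg_mem _ hΘ𝔤
  have hnΘΘ : ∀ v, (-Θ) ((-Θ) v) = v := fun v => by
    rw [LinearMap.neg_apply, LinearMap.neg_apply, map_neg, neg_neg, hΘΘ]
  have hP' : ∀ x ∈ H.piece 0 1, (-Θ) x = x := fun x hx => by rw [LinearMap.neg_apply, hΘ01 x hx, neg_neg]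
  have hQ' : ∀ x ∈ H.piece 1 0, (-Θ) x = -x := fun x hx => by rw [LinearMap.neg_apply, hΘ10 x hx]
  have hPmem' : ∀ v, (2 : ℂ)⁻¹ • (v + (-Θ) v) ∈ H.piece 0 1 := fun v => by
    rw [LinearMap.neg_apply, ← sub_eq_add_neg]; exact hQ v
  have hQmem' : ∀ v, (2 : ℂ)⁻¹ • (v - (-Θ) v) ∈ H.piece 1 0 := fun v => by
    rw [LinearMap.neg_apply, sub_neg_eq_add]; exact hP v
  -- the core theorem for `T = Θ` and for `T = -Θ`
  obtain ⟨hA, hB⟩ := SymplecticTheta.core_of_irreducible ω hωnd hωalt (spanC 𝔤) h𝔊br h𝔊skew hΘ𝔤 hΘΘ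
    (P := H.piece 1 0) (Q := H.piece 0 1) hΘ10 hΘ01 hP hQ hfin.1 hfin.2 hirr
  obtain ⟨hA', -⟩ := SymplecticTheta.core_of_irreducible ω hωnd hωalt (spanC 𝔤) h𝔊br h𝔊skew hnΘ𝔤 hnΘΘ
    (P := H.piece 0 1) (Q := H.piece 1 0) hP' hQ' hPmem' hQmem' hfin.2 hfin.1 hirr
  -- the space of `ψ_ℂ`-skew operators and the grading of `Y`
  let 𝔰 : Submodule ℂ (Module.End ℂ (ℂ ⊗[ℚ] V)) :=
    { carrier := {Z | ∀ x y, ω (Z x) y + ω x (Z y) = 0}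
      zero_mem' := fun x y => by simp
      add_mem' := by
        intro Z Z' hZ hZ' x y
        simp only [LinearMap.add_apply, map_add]
        have h1 := hZ x y
        have h2 := hZ' x y
        linear_combination h1 + h2
      smul_mem' := by
        intro c Z hZ x y
        simp only [LinearMap.smul_apply, map_smul, smul_eq_mul]
        have h1 := hZ x y
        linear_combination c * h1 }
  have hmem𝔰 : ∀ Z, Z ∈ 𝔰 ↔ ∀ x y, ω (Z x) y + ω x (Z y) = 0 := fun Z => Iff.rfl
  have h𝔰br : ∀ Z ∈ 𝔰, ∀ Z' ∈ 𝔰, Z * Z' - Z' * Z ∈ 𝔰 := fun Z hZ Z' hZ' =>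
    (hmem𝔰 _).2 (SymplecticTheta.skew_commutator ω ((hmem𝔰 Z).1 hZ) ((hmem𝔰 Z').1 hZ'))
  have hΘ𝔰 : Θ ∈ 𝔰 := (hmem𝔰 Θ).2 (h𝔊skew Θ hΘ𝔤)
  have hY𝔰 : Y ∈ 𝔰 := (hmem𝔰 Y).2 hYskew
  obtain ⟨Ym, hYm, Y0, hY0, Yp, hYp, hYeq, hYpP, hYpim, hYmQ, hYmim, -, -, hY0P, hY0Q⟩ :=
    SymplecticTheta.exists_decomp 𝔰 h𝔰br hΘ𝔰 hΘΘ (P := H.piece 1 0) (Q := H.piece 0 1) hΘ10 hΘ01 hP hQ hY𝔰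
  rw [hYeq]
  refine Submodule.add_mem _ (Submodule.add_mem _ ?_ ?_) ?_
  · exact hA' Ym ((hmem𝔰 Ym).1 hYm) hYmQ hYmim
  · exact hB Y0 ((hmem𝔰 Y0).1 hY0) hY0P hY0Q
  · exact hA Yp ((hmem𝔰 Yp).1 hYp) hYpP hYpim

/-- **`𝔤_ℂ = 𝔰𝔭(V, ψ)_ℂ` as an equivalence**: `Y ∈ 𝔤_ℂ` iff `Y` is `ψ_ℂ`-skew.
[cite: MoonenZarhin1999LowDim, §2 (2.2)] -/
theorem SymplecticTheta.mem_spanC_iff_skew [Module.Finite ℚ V] (H : HodgeStructure V n) (hn : n = 1)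
    (heff : H.IsEffective) (ψ : H.Polarization) (hE : ∀ a ∈ H.endAlg, ∃ x : ℚ, a = x • 1)
    (hV : Module.finrank ℚ V = 4) (𝔤 : Submodule ℚ (Module.End ℚ V))
    (hbr : ∀ X ∈ 𝔤, ∀ X' ∈ 𝔤, X * X' - X' * X ∈ 𝔤) {Θ : Module.End ℂ (ℂ ⊗[ℚ] V)}
    (hΘ : ∀ p, ∀ x ∈ H.piece p (n - p), Θ x = ((2 * p - n : ℤ) : ℂ) • x) (hΘ𝔤 : Θ ∈ spanC 𝔤)
    (hskew : ∀ X ∈ 𝔤, ∀ v w, ψ.form (X v) w + ψ.form v (X w) = 0) (Y : Module.End ℂ (ℂ ⊗[ℚ] V)) :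
    Y ∈ spanC 𝔤 ↔ ∀ x y, ψ.form.baseChange ℂ (Y x) y + ψ.form.baseChange ℂ x (Y y) = 0 :=
  ⟨fun hY => ThetaSubalgebra.formBaseChange_add_eq_zero_of_mem_spanC ψ hskew hY,
    fun hY => SymplecticTheta.mem_spanC_of_skew H hn heff ψ hE hV 𝔤 hbr hΘ hΘ𝔤 hskew hY⟩

/-- **`𝔤 = 𝔰𝔭(V, ψ)` over `ℚ`** (descent `X ∈ 𝔤 ↔ X_ℂ ∈ 𝔤_ℂ`): a rational operator lies in `𝔤` iff it is
`ψ`-skew. [cite: MoonenZarhin1999LowDim, §2 (2.2)] [cite: Deligne1982HodgeCycles, I §3 (proof of Prop. 3.4)] -/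
theorem SymplecticTheta.mem_iff_skew [Module.Finite ℚ V] (H : HodgeStructure V n) (hn : n = 1)
    (heff : H.IsEffective) (ψ : H.Polarization) (hE : ∀ a ∈ H.endAlg, ∃ x : ℚ, a = x • 1)
    (hV : Module.finrank ℚ V = 4) (𝔤 : Submodule ℚ (Module.End ℚ V))
    (hbr : ∀ X ∈ 𝔤, ∀ X' ∈ 𝔤, X * X' - X' * X ∈ 𝔤) {Θ : Module.End ℂ (ℂ ⊗[ℚ] V)}
    (hΘ : ∀ p, ∀ x ∈ H.piece p (n - p), Θ x = ((2 * p - n : ℤ) : ℂ) • x) (hΘ𝔤 : Θ ∈ spanC 𝔤)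
    (hskew : ∀ X ∈ 𝔤, ∀ v w, ψ.form (X v) w + ψ.form v (X w) = 0) (X : Module.End ℚ V) :
    X ∈ 𝔤 ↔ ∀ v w, ψ.form (X v) w + ψ.form v (X w) = 0 := by
  refine ⟨hskew X, fun hX => ?_⟩
  exact mem_of_baseChange_mem_spanC 𝔤 (SymplecticTheta.mem_spanC_of_skew H hn heff ψ hE hV 𝔤 hbr hΘ hΘ𝔤 hskew
    (ThetaSubalgebra.formBaseChange_add_eq_zero_of_skew ψ hX))

/-- **`Lie Hg(H) = 𝔰𝔭(V, ψ)` (Moonen–Zarhin 1999 (2.2), Type I(1), `g = 2`: "`Hg(X) = Sp(V,φ) ≅ Sp_{4,ℚ}`",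
infinitesimally):** for an effective polarized weight-one `H` with `dim V = 4` and `End_Hdg(V) = ℚ`, a rational
operator lies in the Lie algebra of the Hodge group iff it is `ψ`-skew. `Lie Hg(H)` is admissible:
bracket-closed (`commutator_mem_hodgeLie`), `Θ ∈ Lie Hg ⊗ ℂ` (`mem_hodgeLieC_of_forall_piece`), `ψ`-skew
(`form_apply_add_eq_zero_of_mem_hodgeLie`). [cite: MoonenZarhin1999LowDim, §2 (2.2) and (1.8)]
[cite: Huybrechts2016K3, Thm. 3.3.9 (proof, p. 67)] -/
theorem SymplecticTheta.mem_hodgeLie_iff_skew [Module.Finite ℚ V] [HodgeTensorFacts.{u, u}] (H : HodgeStructure V n)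
    (hn : n = 1) (heff : H.IsEffective) (ψ : H.Polarization) (hE : ∀ a ∈ H.endAlg, ∃ x : ℚ, a = x • 1)
    (hV : Module.finrank ℚ V = 4) (X : Module.End ℚ V) :
    X ∈ H.hodgeLie ↔ ∀ v w, ψ.form (X v) w + ψ.form v (X w) = 0 := by
  obtain ⟨Θ, hΘ⟩ := exists_hodgeTheta H
  have hΘ𝔤 : Θ ∈ spanC H.hodgeLie := (hodgeLieC_eq_spanC H) ▸ H.mem_hodgeLieC_of_forall_piece hΘ
  exact SymplecticTheta.mem_iff_skew H hn heff ψ hE hV H.hodgeLie (fun X hX Y hY => H.commutator_mem_hodgeLie hX hY)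
    hΘ hΘ𝔤 (fun X hX => form_apply_add_eq_zero_of_mem_hodgeLie ψ hX) X

/-- **`𝔤 = Lie Hg(H)`: `Lie Hg(H)` is the only rational Lie subalgebra of `𝔰𝔭(V, ψ)` whose complexification
contains `Θ`** (Deligne's minimality, LNM 900 I Prop. 3.4, in Lie form, for the generic rank-four case).
[cite: Deligne1982HodgeCycles, I §3 Prop. 3.4] [cite: MoonenZarhin1999LowDim, §2 (2.2)] -/
theorem SymplecticTheta.eq_hodgeLie [Module.Finite ℚ V] [HodgeTensorFacts.{u, u}] (H : HodgeStructure V n)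
    (hn : n = 1) (heff : H.IsEffective) (ψ : H.Polarization) (hE : ∀ a ∈ H.endAlg, ∃ x : ℚ, a = x • 1)
    (hV : Module.finrank ℚ V = 4) (𝔤 : Submodule ℚ (Module.End ℚ V))
    (hbr : ∀ X ∈ 𝔤, ∀ X' ∈ 𝔤, X * X' - X' * X ∈ 𝔤) {Θ : Module.End ℂ (ℂ ⊗[ℚ] V)}
    (hΘ : ∀ p, ∀ x ∈ H.piece p (n - p), Θ x = ((2 * p - n : ℤ) : ℂ) • x) (hΘ𝔤 : Θ ∈ spanC 𝔤)
    (hskew : ∀ X ∈ 𝔤, ∀ v w, ψ.form (X v) w + ψ.form v (X w) = 0) : 𝔤 = H.hodgeLie := by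
  ext X
  rw [SymplecticTheta.mem_iff_skew H hn heff ψ hE hV 𝔤 hbr hΘ hΘ𝔤 hskew,
    SymplecticTheta.mem_hodgeLie_iff_skew H hn heff ψ hE hV]

end Main

/-! ### §4 Theorem L-Sp: rational tensors killed by `Θ` are killed by `𝔰𝔭(V_ℂ, ψ_ℂ)` -/

section AnnLie

open Literature.RepresentationTheory.GeneralLinear Literature.NumberTheory.DiophantineGeometry

universe u

variable {V : Type u} [AddCommGroup V] [Module ℚ V] {n : ℤ} {M N k : ℕ}

/-- **Theorem L-Sp (invariance of rational tensors under `𝔰𝔭(V_ℂ, ψ_ℂ)`; the Lie step of `B(Xⁿ) = D(Xⁿ)` for a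
generic abelian surface).** In the setting of `SymplecticTheta.mem_spanC_of_skew`, let `q` be a rational
coefficient tensor (letters: slots `Fin k` × a `ℚ`-basis `eQ` of `V`) killed — slice by slice, diagonally — by
the matrix of the Hodge operator `Θ`. Then `q` is killed by the matrix of EVERY `ψ_ℂ`-skew operator `Y` of
`V_ℂ`. Proof: the rational Lie algebra `𝔞 ⊆ 𝔰𝔭(V, ψ)` of operators killing `q` (`annLie`, with `End_Hdg(V)` as
commuting family) is bracket-closed and `Θ ∈ 𝔞_ℂ` by descent (`mem_spanC_annLie`, Deligne LNM 900 I §3), so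
`𝔞_ℂ = 𝔰𝔭(V_ℂ, ψ_ℂ) ∋ Y` by the theorem, and `𝔞_ℂ` kills `q_ℂ`. (MZ99 p. 715: "`Hg(X) = Sp_D(V,φ)` […] it
follows that `B(Xⁿ) = D(Xⁿ)` for all `n`"; the passage to divisor classes is by the invariant theory of `Sp`,
Milne 1999 Prop. 3.6 (a).) [cite: MoonenZarhin1999LowDim, §2 p. 715 and (2.2), §1 (1.8)]
[cite: Deligne1982HodgeCycles, I §3 (proof of Prop. 3.4)] [cite: Milne1999LefschetzClasses, Prop. 3.6 (a)] -/
theorem SymplecticTheta.wordDerAt_eq_zero_of_skew [Module.Finite ℚ V] [HodgeTensorFacts.{u, u}]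
    (H : HodgeStructure V n) (hn : n = 1) (heff : H.IsEffective) (ψ : H.Polarization)
    (hE : ∀ a ∈ H.endAlg, ∃ x : ℚ, a = x • 1) (hV : Module.finrank ℚ V = 4)
    (eQ : Module.Basis (Fin M) ℚ V) (q : (Fin N → Fin k × Fin M) → ℚ) {Θ : Module.End ℂ (ℂ ⊗[ℚ] V)}
    (hΘ : ∀ p, ∀ x ∈ H.piece p (n - p), Θ x = ((2 * p - n : ℤ) : ℂ) • x)
    (hΘq : ∀ u : Fin N → Fin k, wordDerAt ℂ (fun _ : Fin N =>
      LinearMap.toMatrix (Algebra.TensorProduct.basis ℂ eQ) (Algebra.TensorProduct.basis ℂ eQ) Θ)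
      (wordSlice (fun w => algebraMap ℚ ℂ (q w)) u) = 0)
    {Y : Module.End ℂ (ℂ ⊗[ℚ] V)}
    (hYskew : ∀ x y, ψ.form.baseChange ℂ (Y x) y + ψ.form.baseChange ℂ x (Y y) = 0) (u : Fin N → Fin k) :
    wordDerAt ℂ (fun _ : Fin N =>
      LinearMap.toMatrix (Algebra.TensorProduct.basis ℂ eQ) (Algebra.TensorProduct.basis ℂ eQ) Y)
      (wordSlice (fun w => algebraMap ℚ ℂ (q w)) u) = 0 := by
  -- the rational Lie algebra `𝔞 ⊆ 𝔰𝔭(V, ψ)` of `q`, with `E = End_Hdg(V)` as commuting family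
  set 𝔞 : Submodule ℚ (Module.End ℚ V) := annLie ψ.form eQ (fun a : H.endAlg => (a : Module.End ℚ V)) q
    with h𝔞
  have hΘC : Θ ∈ H.hodgeLieC := H.mem_hodgeLieC_of_forall_piece hΘ
  have hΘ𝔞 : Θ ∈ spanC 𝔞 :=
    mem_spanC_annLie ψ.form eQ _ q hΘq (fun a => commute_baseChange_of_mem_hodgeLieC H hΘC a)
      fun x y => by rw [formBaseChange_skew_of_mem_hodgeLieC ψ hΘC, neg_add_cancel]
  have hbr : ∀ X ∈ 𝔞, ∀ X' ∈ 𝔞, X * X' - X' * X ∈ 𝔞 := fun X hX X' hX' =>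
    commutator_mem_annLie ψ.form eQ _ q hX hX'
  have hskew : ∀ X ∈ 𝔞, ∀ v w, ψ.form (X v) w + ψ.form v (X w) = 0 :=
    fun X hX => ((mem_annLie_iff ψ.form eQ _ q X).1 hX).2.2
  have hY : Y ∈ spanC 𝔞 := SymplecticTheta.mem_spanC_of_skew H hn heff ψ hE hV 𝔞 hbr hΘ hΘ𝔞 hskew hYskew
  rw [h𝔞] at hY
  exact wordDerAt_eq_zero_of_mem_spanC_annLie ψ.form eQ _ q hY u

end AnnLie

end HodgeStructure

end Literature.AlgebraicGeometry.Motives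

end
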